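import Summits.Ventures.HodgeRepro.CyclicRecipeArith

/-!
# The cyclic recipe, part 2 of 3: the recipe type on `ℤ/N`, its twists, and the single-class `SumTwo` quadruple

Blind re-derivation cell `pub-hodge-repro`, seat `p1` (gen 9; split by p1 gen 10 at section boundaries for the cell's
≤ 400-line landing rule, declaration text unchanged).  On `N = 2rpq` (`r ≥ 2`, `p ≠ q` odd primes): the recipe CM type
`Φ N r p q` (the typer's `Finset (Multiplicative (ZMod N))`), the involution `cc = rpq`, the twists `gg` by
`0, rq, rp, rq + rp` and the quadruple `T`; the CM condition, `SumTwo` (a pairing argument), the absence of a conjugate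
pair and primitivity (both from ONE half-interval lemma), and the first existence theorem
`exists_singleClass_sumTwo_primitive_cyclic`.  Part 1 (`CyclicRecipeArith.lean`) is the `ℕ` arithmetic; part 3
(`CyclicRecipe.lean`) the Pohlmann `4`-set, the `m`-form and the instances.  Mathematics: see part 3's docstring.
-/

set_option autoImplicit false

open Finset
open scoped Pointwise

namespace HodgeRepro.CyclicRecipe

/-! ### The recipe type, the involution and the twists on `ℤ/N` -/

variable {N : ℕ} [NeZero N]

/-- The recipe CM type `Φ ⊂ ℤ/N` as the typer's `Finset (Multiplicative (ZMod N))`. -/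
def Φ (N r p q : ℕ) [NeZero N] : Finset (Multiplicative (ZMod N)) :=
  univ.filter fun x => InPhi r p q (Multiplicative.toAdd x).val

/-- The involution `c = m = rpq` of `ℤ/N`. -/
def cc (N r p q : ℕ) : Multiplicative (ZMod N) := Multiplicative.ofAdd ((r * p * q : ℕ) : ZMod N)

/-- The twists `0, rq, rp, rq + rp` as natural numbers. -/
def gn (r p q : ℕ) : Fin 4 → ℕ := ![0, r * q, r * p, r * q + r * p]

/-- The twists `0, rq, rp, rq + rp` in `ℤ/N`. -/
def gg (N r p q : ℕ) (i : Fin 4) : Multiplicative (ZMod N) := Multiplicative.ofAdd ((gn r p q i : ℕ) : ZMod N)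

/-- The quadruple `T i = Φ · g i`. -/
def T (N r p q : ℕ) [NeZero N] (i : Fin 4) : Finset (Multiplicative (ZMod N)) := rmul (Φ N r p q) (gg N r p q i)

omit [NeZero N] in
/-- `(x + d).val = (x.val + d) mod N`. -/
theorem val_add_natCast [NeZero N] (x : ZMod N) (d : ℕ) : (x + (d : ZMod N)).val = (x.val + d) % N := by
  rw [ZMod.val_add, ZMod.val_natCast, Nat.add_mod_mod]

/-- Membership in `Φ`, read on the natural representative. -/
theorem mem_Φ {r p q : ℕ} (x : Multiplicative (ZMod N)) :
    x ∈ Φ N r p q ↔ InPhi r p q (Multiplicative.toAdd x).val := by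
  simp [Φ]

/-- Membership of `x + d` (`d : ℕ`) in `Φ`, read on the natural representative. -/
theorem mem_Φ_add {r p q : ℕ} (hr : r ∣ N) (hp : 2 * (r * p) ∣ N) (hq : 2 * (r * q) ∣ N) (x : ZMod N) (d : ℕ) :
    Multiplicative.ofAdd (x + (d : ZMod N)) ∈ Φ N r p q ↔ InPhi r p q (x.val + d) := by
  rw [mem_Φ, toAdd_ofAdd, val_add_natCast, inPhi_mod hr hp hq]

/-- Membership of `x + (a + b)` in the twist `Φ · b`. -/
theorem mem_rmul_Φ {r p q : ℕ} (hr : r ∣ N) (hp : 2 * (r * p) ∣ N) (hq : 2 * (r * q) ∣ N) (x : ZMod N) (a b : ℕ) :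
    Multiplicative.ofAdd (x + ((a + b : ℕ) : ZMod N)) ∈ rmul (Φ N r p q) (Multiplicative.ofAdd (b : ZMod N)) ↔
      InPhi r p q (x.val + a) := by
  rw [mem_rmul, ← ofAdd_neg, ← ofAdd_add]
  have e : x + ((a + b : ℕ) : ZMod N) + -((b : ℕ) : ZMod N) = x + (a : ZMod N) := by push_cast; ring
  rw [e, mem_Φ_add hr hp hq]

section main

variable {r p q : ℕ} (hN : N = 2 * (r * p * q))
include hN

omit [NeZero N] in
/-- `r ∣ N`. -/
theorem r_dvd : r ∣ N := ⟨2 * (p * q), by rw [hN]; ring⟩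
omit [NeZero N] in
/-- `P₂ = 2rp ∣ N`. -/
theorem rp_dvd : 2 * (r * p) ∣ N := ⟨q, by rw [hN]; ring⟩
omit [NeZero N] in
/-- `P₁ = 2rq ∣ N`. -/
theorem rq_dvd : 2 * (r * q) ∣ N := ⟨p, by rw [hN]; ring⟩

/-- `Φ` is a CM type for the involution `m = rpq` (`p`, `q` odd, `r ≥ 1`). -/
theorem isCMType_Φ (hr0 : 0 < r) (hp : Odd p) (hq : Odd q) : IsCMType (cc N r p q) (Φ N r p q) := by
  intro x
  rw [← ofAdd_toAdd x, cc, ← ofAdd_add, add_comm, mem_Φ_add (r_dvd hN) (rp_dvd hN) (rq_dvd hN), mem_Φ, toAdd_ofAdd,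
    inPhi_add_half hr0 hp hq, not_not]

/-- Every element of `ℤ/N` lies in exactly two of the four corners `Φ · g i`, `g = (0, rq, rp, rq + rp)`. -/
theorem sumTwo_T (hr : 2 ≤ r) (hp0 : 0 < p) (hq0 : 0 < q) : SumTwo (T N r p q) := by
  have hrN := r_dvd hN
  have hpN := rp_dvd hN
  have hqN := rq_dvd hN
  intro x
  set y : ZMod N := Multiplicative.toAdd x - ((r * q + r * p : ℕ) : ZMod N) with hy
  have hx : x = Multiplicative.ofAdd (y + ((r * q + r * p : ℕ) : ZMod N)) := by
    rw [hy, sub_add_cancel, ofAdd_toAdd]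
  have m0 : x ∈ T N r p q 0 ↔ InPhi r p q (y.val + (r * q + r * p)) := by
    rw [T, hx, show (r * q + r * p : ℕ) = (r * q + r * p) + 0 from (Nat.add_zero _).symm]
    exact mem_rmul_Φ hrN hpN hqN y (r * q + r * p) 0
  have m1 : x ∈ T N r p q 1 ↔ InPhi r p q (y.val + r * p) := by
    rw [T, hx, show (r * q + r * p : ℕ) = r * p + r * q from Nat.add_comm _ _]
    exact mem_rmul_Φ hrN hpN hqN y (r * p) (r * q)
  have m2 : x ∈ T N r p q 2 ↔ InPhi r p q (y.val + r * q) := by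
    rw [T, hx]
    exact mem_rmul_Φ hrN hpN hqN y (r * q) (r * p)
  have m3 : x ∈ T N r p q 3 ↔ InPhi r p q y.val := by
    rw [T, hx, show (r * q + r * p : ℕ) = 0 + (r * q + r * p) from (Nat.zero_add _).symm]
    exact (mem_rmul_Φ hrN hpN hqN y 0 (r * q + r * p)).trans (by rw [Nat.add_zero])
  rw [Finset.card_filter, Fin.sum_univ_four]
  by_cases hv : y.val % r = 1
  · -- pairs {x, x − rp} and {x − rq, x − rq − rp}
    have f1 : InPhi r p q (y.val + r * p) ↔ ¬ InPhi r p q y.val := inPhi_add_rp (by omega) hp0 hv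
    have f2 : InPhi r p q (y.val + r * q + r * p) ↔ ¬ InPhi r p q (y.val + r * q) :=
      inPhi_add_rp (by omega) hp0 (by rw [Nat.add_mul_mod_self_left]; exact hv)
    rw [← Nat.add_assoc] at m0
    by_cases h3 : InPhi r p q y.val <;> by_cases h2 : InPhi r p q (y.val + r * q) <;> simp [m0, m1, m2, m3, f1, f2, h3, h2]
  · -- pairs {x, x − rq} and {x − rp, x − rp − rq}
    have f1 : InPhi r p q (y.val + r * q) ↔ ¬ InPhi r p q y.val := inPhi_add_rq (by omega) hq0 hv
    have f2 : InPhi r p q (y.val + r * p + r * q) ↔ ¬ InPhi r p q (y.val + r * p) :=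
      inPhi_add_rq (by omega) hq0 (by rw [Nat.add_mul_mod_self_left]; exact hv)
    rw [show y.val + (r * q + r * p) = y.val + r * p + r * q by ring] at m0
    by_cases h3 : InPhi r p q y.val <;> by_cases h1 : InPhi r p q (y.val + r * p) <;> simp [m0, m1, m2, m3, f1, f2, h3, h1]

omit hN in
/-- `T 0 = Φ`. -/
theorem T_zero : T N r p q 0 = Φ N r p q := by
  simp [T, gg, gn]

omit hN in
/-- `T` is single-class by construction. -/
theorem isSingleClass_T : IsSingleClass (T N r p q) := fun i => ⟨gg N r p q i, by rw [T_zero]; rfl⟩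

/-- **Refuting a conjugate pair by two points.**  If `u + g i ∈ Φ` and `u + g j ∈ Φ` (natural representatives) then
`Φ · g j ≠ c • Φ · g i`: otherwise `w = c⁻¹ (u + g i + g j) (g i)⁻¹ ∈ Φ` and `c w = u + g j ∈ Φ`, against the CM condition. -/
theorem T_ne_smul_of_pair (hr0 : 0 < r) (hp : Odd p) (hq : Odd q) (i j : Fin 4) (u : ℕ)
    (hi : InPhi r p q (u + gn r p q i)) (hj : InPhi r p q (u + gn r p q j)) :
    T N r p q j ≠ cc N r p q • T N r p q i := by
  intro heq
  have hΦ := isCMType_Φ hN hr0 hp hq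
  have hrN := r_dvd hN
  have hpN := rp_dvd hN
  have hqN := rq_dvd hN
  set z : Multiplicative (ZMod N) := Multiplicative.ofAdd ((u + gn r p q i + gn r p q j : ℕ) : ZMod N) with hz
  have hzj : z ∈ T N r p q j := by
    rw [T, gg, mem_rmul, hz, ← ofAdd_neg, ← ofAdd_add]
    have e : ((u + gn r p q i + gn r p q j : ℕ) : ZMod N) + -((gn r p q j : ℕ) : ZMod N) =
        (0 : ZMod N) + ((u + gn r p q i : ℕ) : ZMod N) := by push_cast; ring
    rw [e, mem_Φ_add hrN hpN hqN, ZMod.val_zero, Nat.zero_add]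
    exact hi
  have hzi : z * (gg N r p q i)⁻¹ ∈ Φ N r p q := by
    rw [gg, hz, ← ofAdd_neg, ← ofAdd_add]
    have e : ((u + gn r p q i + gn r p q j : ℕ) : ZMod N) + -((gn r p q i : ℕ) : ZMod N) =
        (0 : ZMod N) + ((u + gn r p q j : ℕ) : ZMod N) := by push_cast; ring
    rw [e, mem_Φ_add hrN hpN hqN, ZMod.val_zero, Nat.zero_add]
    exact hj
  rw [heq, ← Finset.inv_smul_mem_iff, smul_eq_mul, T, mem_rmul] at hzj
  apply (hΦ _).mp hzj
  rw [show cc N r p q * ((cc N r p q)⁻¹ * z * (gg N r p q i)⁻¹) = z * (gg N r p q i)⁻¹ by group]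
  exact hzi

omit hN in
/-- `q ≢ p (mod 2p)` for distinct primes. -/
theorem q_mod_ne (hp : p.Prime) (hq : q.Prime) (hpq : p ≠ q) : q % (2 * p) ≠ p := by
  intro h
  have hd := Nat.div_add_mod q (2 * p)
  have : p ∣ q := ⟨2 * (q / (2 * p)) + 1, by
    calc q = 2 * p * (q / (2 * p)) + p := by omega
      _ = p * (2 * (q / (2 * p)) + 1) := by ring⟩
  exact hpq ((Nat.prime_dvd_prime_iff_eq hp hq).mp this)

omit hN in
/-- `p + q ≢ p (mod 2p)` for distinct primes. -/
theorem add_mod_ne (hp : p.Prime) (hq : q.Prime) (hpq : p ≠ q) : (p + q) % (2 * p) ≠ p := by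
  intro h
  have hd := Nat.div_add_mod (p + q) (2 * p)
  have : p ∣ q := ⟨2 * ((p + q) / (2 * p)), by
    calc q = 2 * p * ((p + q) / (2 * p)) := by omega
      _ = p * (2 * ((p + q) / (2 * p))) := by ring⟩
  exact hpq ((Nat.prime_dvd_prime_iff_eq hp hq).mp this)

omit hN in
/-- Witness `W1`: `u, u + rq ∈ Φ` (on the class `1`). -/
theorem exists_pair_rq (hr : 2 ≤ r) (hp : p.Prime) (hq : q.Prime) (hpq : p ≠ q) :
    ∃ u, InPhi r p q u ∧ InPhi r p q (u + r * q) := by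
  obtain ⟨k, hk1, hk2⟩ := exists_half_pair hp.pos (q_mod_ne hp hq hpq)
  refine ⟨1 + r * k, ?_, ?_⟩
  · exact (inPhi_class1 hr hp.pos).mpr hk1
  · rw [Nat.add_assoc, ← Nat.mul_add]; exact (inPhi_class1 hr hp.pos).mpr hk2

omit hN in
/-- Witness `W2`: `u, u + rp ∈ Φ` (on the class `0`). -/
theorem exists_pair_rp (hr : 2 ≤ r) (hp : p.Prime) (hq : q.Prime) (hpq : p ≠ q) :
    ∃ u, InPhi r p q u ∧ InPhi r p q (u + r * p) := by
  obtain ⟨k, hk1, hk2⟩ := exists_half_pair hq.pos (q_mod_ne hq hp hpq.symm)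
  refine ⟨r * k, ?_, ?_⟩
  · exact (inPhi_class0 hr hq.pos).mpr hk1
  · rw [← Nat.mul_add]; exact (inPhi_class0 hr hq.pos).mpr hk2

omit hN in
/-- Witness `W3`: `u, u + (rq + rp) ∈ Φ` (on the class `1`). -/
theorem exists_pair_rqrp (hr : 2 ≤ r) (hp : p.Prime) (hq : q.Prime) (hpq : p ≠ q) :
    ∃ u, InPhi r p q u ∧ InPhi r p q (u + (r * q + r * p)) := by
  obtain ⟨k, hk1, hk2⟩ := exists_half_pair hp.pos (add_mod_ne hp hq hpq)
  refine ⟨1 + r * k, ?_, ?_⟩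
  · exact (inPhi_class1 hr hp.pos).mpr hk1
  · rw [show 1 + r * k + (r * q + r * p) = 1 + r * (k + (p + q)) by ring]
    exact (inPhi_class1 hr hp.pos).mpr hk2

omit hN in
/-- Witness `W4`: `u + rq, u + rp ∈ Φ` (on the class `1`). -/
theorem exists_pair_rq_rp (hr : 2 ≤ r) (hp : p.Prime) (hq : q.Prime) (hpq : p ≠ q) :
    ∃ u, InPhi r p q (u + r * q) ∧ InPhi r p q (u + r * p) := by
  obtain ⟨k, hk1, hk2⟩ := exists_half_pair hp.pos (add_mod_ne hp hq hpq)
  refine ⟨1 + r * (k + p), ?_, ?_⟩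
  · rw [show 1 + r * (k + p) + r * q = 1 + r * (k + (p + q)) by ring]
    exact (inPhi_class1 hr hp.pos).mpr hk2
  · rw [show 1 + r * (k + p) + r * p = 1 + r * (k + 2 * p) by ring]
    refine (inPhi_class1 hr hp.pos).mpr ?_
    rw [Nat.add_mod_right]; exact hk1

omit hN in
/-- Witness `W5`: `u + rq, u + (rq + rp) ∈ Φ` (on the class `0`). -/
theorem exists_pair_rq_rqrp (hr : 2 ≤ r) (hp : p.Prime) (hq : q.Prime) (hpq : p ≠ q) :
    ∃ u, InPhi r p q (u + r * q) ∧ InPhi r p q (u + (r * q + r * p)) := by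
  obtain ⟨k, hk1, hk2⟩ := exists_half_pair hq.pos (q_mod_ne hq hp hpq.symm)
  refine ⟨r * (k + q), ?_, ?_⟩
  · rw [show r * (k + q) + r * q = r * (k + 2 * q) by ring]
    refine (inPhi_class0 hr hq.pos).mpr ?_
    rw [Nat.add_mod_right]; exact hk1
  · rw [show r * (k + q) + (r * q + r * p) = r * (k + p + 2 * q) by ring]
    refine (inPhi_class0 hr hq.pos).mpr ?_
    rw [Nat.add_mod_right]; exact hk2

omit hN in
/-- Witness `W6`: `u + rp, u + (rq + rp) ∈ Φ` (on the class `1`). -/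
theorem exists_pair_rp_rqrp (hr : 2 ≤ r) (hp : p.Prime) (hq : q.Prime) (hpq : p ≠ q) :
    ∃ u, InPhi r p q (u + r * p) ∧ InPhi r p q (u + (r * q + r * p)) := by
  obtain ⟨k, hk1, hk2⟩ := exists_half_pair hp.pos (q_mod_ne hp hq hpq)
  refine ⟨1 + r * (k + p), ?_, ?_⟩
  · rw [show 1 + r * (k + p) + r * p = 1 + r * (k + 2 * p) by ring]
    refine (inPhi_class1 hr hp.pos).mpr ?_
    rw [Nat.add_mod_right]; exact hk1
  · rw [show 1 + r * (k + p) + (r * q + r * p) = 1 + r * (k + q + 2 * p) by ring]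
    refine (inPhi_class1 hr hp.pos).mpr ?_
    rw [Nat.add_mod_right]; exact hk2

/-- **No two corners are complex-conjugate types.** -/
theorem T_noConjugatePair (hr : 2 ≤ r) (hp : p.Prime) (hq : q.Prime) (hp2 : p ≠ 2) (hq2 : q ≠ 2) (hpq : p ≠ q) :
    ∀ i j : Fin 4, T N r p q j ≠ cc N r p q • T N r p q i := by
  have hr0 : 0 < r := by omega
  have hpo := hp.odd_of_ne_two hp2
  have hqo := hq.odd_of_ne_two hq2
  obtain ⟨u₁, h₁a, h₁b⟩ := exists_pair_rq (p := p) (q := q) hr hp hq hpq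
  obtain ⟨u₂, h₂a, h₂b⟩ := exists_pair_rp (p := p) (q := q) hr hp hq hpq
  obtain ⟨u₃, h₃a, h₃b⟩ := exists_pair_rqrp (p := p) (q := q) hr hp hq hpq
  obtain ⟨u₄, h₄a, h₄b⟩ := exists_pair_rq_rp (p := p) (q := q) hr hp hq hpq
  obtain ⟨u₅, h₅a, h₅b⟩ := exists_pair_rq_rqrp (p := p) (q := q) hr hp hq hpq
  obtain ⟨u₆, h₆a, h₆b⟩ := exists_pair_rp_rqrp (p := p) (q := q) hr hp hq hpq
  have g0 : gn r p q 0 = 0 := rfl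
  have g1 : gn r p q 1 = r * q := rfl
  have g2 : gn r p q 2 = r * p := rfl
  have g3 : gn r p q 3 = r * q + r * p := rfl
  intro i j
  fin_cases i <;> fin_cases j
  · exact T_ne_smul_of_pair hN hr0 hpo hqo 0 0 u₁ (by rw [g0]; exact h₁a) (by rw [g0]; exact h₁a)
  · exact T_ne_smul_of_pair hN hr0 hpo hqo 0 1 u₁ (by rw [g0]; exact h₁a) (by rw [g1]; exact h₁b)
  · exact T_ne_smul_of_pair hN hr0 hpo hqo 0 2 u₂ (by rw [g0]; exact h₂a) (by rw [g2]; exact h₂b)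
  · exact T_ne_smul_of_pair hN hr0 hpo hqo 0 3 u₃ (by rw [g0]; exact h₃a) (by rw [g3]; exact h₃b)
  · exact T_ne_smul_of_pair hN hr0 hpo hqo 1 0 u₁ (by rw [g1]; exact h₁b) (by rw [g0]; exact h₁a)
  · exact T_ne_smul_of_pair hN hr0 hpo hqo 1 1 u₁ (by rw [g1]; exact h₁b) (by rw [g1]; exact h₁b)
  · exact T_ne_smul_of_pair hN hr0 hpo hqo 1 2 u₄ (by rw [g1]; exact h₄a) (by rw [g2]; exact h₄b)
  · exact T_ne_smul_of_pair hN hr0 hpo hqo 1 3 u₅ (by rw [g1]; exact h₅a) (by rw [g3]; exact h₅b)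
  · exact T_ne_smul_of_pair hN hr0 hpo hqo 2 0 u₂ (by rw [g2]; exact h₂b) (by rw [g0]; exact h₂a)
  · exact T_ne_smul_of_pair hN hr0 hpo hqo 2 1 u₄ (by rw [g2]; exact h₄b) (by rw [g1]; exact h₄a)
  · exact T_ne_smul_of_pair hN hr0 hpo hqo 2 2 u₂ (by rw [g2]; exact h₂b) (by rw [g2]; exact h₂b)
  · exact T_ne_smul_of_pair hN hr0 hpo hqo 2 3 u₆ (by rw [g2]; exact h₆a) (by rw [g3]; exact h₆b)
  · exact T_ne_smul_of_pair hN hr0 hpo hqo 3 0 u₃ (by rw [g3]; exact h₃b) (by rw [g0]; exact h₃a)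
  · exact T_ne_smul_of_pair hN hr0 hpo hqo 3 1 u₅ (by rw [g3]; exact h₅b) (by rw [g1]; exact h₅a)
  · exact T_ne_smul_of_pair hN hr0 hpo hqo 3 2 u₆ (by rw [g3]; exact h₆b) (by rw [g2]; exact h₆a)
  · exact T_ne_smul_of_pair hN hr0 hpo hqo 3 3 u₃ (by rw [g3]; exact h₃b) (by rw [g3]; exact h₃b)

/-- **A period of `Φ` is trivial.**  If `Φ · η = Φ` for `η < N` then `η = 0`: a period must preserve the residue classes
mod `r` (otherwise the class `1 − η` carries both half-interval flips, refuted by `exists_half_pair`), and a period `r t`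
must be a period of both half-interval rules, `2p ∣ t` and `2q ∣ t`, so `N ∣ η`. -/
theorem period_eq_zero (hr : 2 ≤ r) (hp : p.Prime) (hq : q.Prime) (hq2 : q ≠ 2) (hpq : p ≠ q)
    (η : ℕ) (hη : η < N) (hh : rmul (Φ N r p q) (Multiplicative.ofAdd (η : ZMod N)) = Φ N r p q) : η = 0 := by
  have hrN := r_dvd hN
  have hpN := rp_dvd hN
  have hqN := rq_dvd hN
  have hp0 := hp.pos
  have hq0 := hq.pos
  have key : ∀ u : ℕ, InPhi r p q (u + η) ↔ InPhi r p q u := by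
    intro u
    have h1 := mem_rmul_Φ (N := N) hrN hpN hqN 0 u η
    rw [hh, mem_Φ_add hrN hpN hqN, ZMod.val_zero, Nat.zero_add, Nat.zero_add] at h1
    exact h1
  -- Step 1: `r ∣ η`
  have hρ : η % r = 0 := by
    by_contra hρ
    have hd := Nat.div_add_mod η r
    obtain ⟨y₀, ε, hy₀, hy₀1, hsum⟩ : ∃ y₀ ε : ℕ, y₀ < r ∧ y₀ ≠ 1 ∧ y₀ + η % r = 1 + r * ε := by
      by_cases h1 : η % r = 1
      · exact ⟨0, 0, by omega, by omega, by omega⟩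
      · have := Nat.mod_lt η (by omega : 0 < r)
        exact ⟨1 + r - η % r, 1, by omega, by omega, by omega⟩
    have mem1 : ∀ k, InPhi r p q (y₀ + r * k) ↔ k % (2 * q) < q := fun k => inPhi_class hy₀ hy₀1 hq0
    have mem2 : ∀ k, InPhi r p q (y₀ + r * k + η) ↔ (k + (η / r + ε)) % (2 * p) < p := by
      intro k
      have e : y₀ + r * k + η = 1 + r * (k + (η / r + ε)) := by
        rw [Nat.mul_add, Nat.mul_add]; omega
      rw [e]; exact inPhi_class1 hr hp0
    obtain ⟨k₀, hk₀, hk₀q⟩ := exists_half_pair hp0 (q_mod_ne hp hq hpq)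
    have e1 : (k₀ + (η / r + ε) * (2 * p - 1) + (η / r + ε)) % (2 * p) = k₀ % (2 * p) := shift_mod hp0
    have e2 : (k₀ + (η / r + ε) * (2 * p - 1) + q + (η / r + ε)) % (2 * p) = (k₀ + q) % (2 * p) := by
      rw [show k₀ + (η / r + ε) * (2 * p - 1) + q + (η / r + ε) =
        (k₀ + q) + (η / r + ε) * (2 * p - 1) + (η / r + ε) by ring]
      exact shift_mod hp0
    have A1 : InPhi r p q (y₀ + r * (k₀ + (η / r + ε) * (2 * p - 1))) := by
      rw [← key, mem2, e1]; exact hk₀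
    have A2 : InPhi r p q (y₀ + r * (k₀ + (η / r + ε) * (2 * p - 1) + q)) := by
      rw [← key, mem2, e2]; exact hk₀q
    rw [mem1] at A1 A2
    exact (half_flip hq0 _).mp A2 A1
  -- Step 2: `η = r t` with `2p ∣ t` and `2q ∣ t`
  have ht : η = r * (η / r) := by have := Nat.div_add_mod η r; omega
  have keyB : ∀ k, (k + η / r) % (2 * p) < p ↔ k % (2 * p) < p := by
    intro k
    have := key (1 + r * k)
    rw [ht, show 1 + r * k + r * (η / r) = 1 + r * (k + η / r) by ring, inPhi_class1 hr hp0,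
      inPhi_class1 hr hp0] at this
    exact this
  have keyA : ∀ k, (k + η / r) % (2 * q) < q ↔ k % (2 * q) < q := by
    intro k
    have := key (r * k)
    rw [ht, ← Nat.mul_add, inPhi_class0 hr hq0, inPhi_class0 hr hq0] at this
    exact this
  have h2p : 2 * p ∣ η / r := by
    have b0 : (η / r) % (2 * p) < p := by
      have := (keyB 0).mpr (by rw [Nat.zero_mod]; exact hp0)
      rwa [Nat.zero_add] at this
    have b1 : (p - 1 + η / r) % (2 * p) < p :=
      (keyB (p - 1)).mpr (by rw [Nat.mod_eq_of_lt (by omega)]; omega)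
    rw [Nat.add_mod, Nat.mod_eq_of_lt (by omega : p - 1 < 2 * p),
      Nat.mod_eq_of_lt (by omega : p - 1 + η / r % (2 * p) < 2 * p)] at b1
    exact Nat.dvd_of_mod_eq_zero (by omega)
  have h2q : 2 * q ∣ η / r := by
    have b0 : (η / r) % (2 * q) < q := by
      have := (keyA 0).mpr (by rw [Nat.zero_mod]; exact hq0)
      rwa [Nat.zero_add] at this
    have b1 : (q - 1 + η / r) % (2 * q) < q :=
      (keyA (q - 1)).mpr (by rw [Nat.mod_eq_of_lt (by omega)]; omega)
    rw [Nat.add_mod, Nat.mod_eq_of_lt (by omega : q - 1 < 2 * q),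
      Nat.mod_eq_of_lt (by omega : q - 1 + η / r % (2 * q) < 2 * q)] at b1
    exact Nat.dvd_of_mod_eq_zero (by omega)
  have hq_t : q ∣ η / r := (Dvd.intro_left 2 rfl).trans h2q
  have hcop : Nat.Coprime (2 * p) q :=
    Nat.Coprime.mul_left ((Nat.coprime_primes Nat.prime_two hq).mpr (Ne.symm hq2))
      ((Nat.coprime_primes hp hq).mpr hpq)
  have hN_dvd : N ∣ η := by
    have := Nat.mul_dvd_mul_left r (hcop.mul_dvd_of_dvd_of_dvd h2p hq_t)
    rw [← ht] at this
    rw [hN, show 2 * (r * p * q) = r * (2 * p * q) by ring]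
    exact this
  exact Nat.eq_zero_of_dvd_of_lt hN_dvd hη

/-- **`Φ` is primitive**: `A_Φ` is a SIMPLE CM abelian variety of dimension `m = rpq`. -/
theorem isPrimitive_Φ (hr : 2 ≤ r) (hp : p.Prime) (hq : q.Prime) (hq2 : q ≠ 2) (hpq : p ≠ q) :
    IsPrimitive (Φ N r p q) := by
  intro h hh
  have e : h = Multiplicative.ofAdd (((Multiplicative.toAdd h).val : ℕ) : ZMod N) := by
    rw [ZMod.natCast_zmod_val, ofAdd_toAdd]
  rw [e] at hh
  have h0 := period_eq_zero hN hr hp hq hq2 hpq _ (ZMod.val_lt _) hh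
  rw [e, h0, Nat.cast_zero, ofAdd_zero]

/-- **The cyclic recipe.**  On the cyclic group of order `N = 2rpq` (`r ≥ 2`, `p ≠ q` odd primes) with involution
`m = rpq`, a PRIMITIVE CM type carries a single-class `SumTwo` quadruple without a complex-conjugate pair: the general
«yes» direction of the cyclic classification (the «no» directions are `CyclicPrimePowerNoSingleClass` for `m = 2^a q^b`
and `CyclicTwoPrimesNoSingleClass` for `m = pq`). -/
theorem exists_singleClass_sumTwo_primitive_cyclic (hr : 2 ≤ r) (hp : p.Prime) (hq : q.Prime) (hp2 : p ≠ 2)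
    (hq2 : q ≠ 2) (hpq : p ≠ q) :
    ∃ T : Fin 4 → Finset (Multiplicative (ZMod N)),
      IsCMType (Multiplicative.ofAdd ((r * p * q : ℕ) : ZMod N)) (T 0) ∧ IsPrimitive (T 0) ∧ SumTwo T ∧
      (∀ i j : Fin 4, T j ≠ Multiplicative.ofAdd ((r * p * q : ℕ) : ZMod N) • T i) ∧ IsSingleClass T := by
  refine ⟨T N r p q, ?_, ?_, sumTwo_T hN hr hp.pos hq.pos, T_noConjugatePair hN hr hp hq hp2 hq2 hpq,
    isSingleClass_T⟩
  · rw [T_zero]; exact isCMType_Φ hN (by omega) (hp.odd_of_ne_two hp2) (hq.odd_of_ne_two hq2)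
  · rw [T_zero]; exact isPrimitive_Φ hN hr hp hq hq2 hpq


end main

end HodgeRepro.CyclicRecipe
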